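import Literature.MathematicalPhysics.QuantumFieldTheory.Balaban1983to89.B16MergeGeometry

/-!
# `Balaban1983to89.T4SizeLedger` — LEMMA Y step (2) «Fatness and the SIZE LEDGER» ON THE CELL'S MODEL
(cell `pub-balaban`, rung (B)+1, node U5; record `t4/T4-EST-U5E-rem.md` v1.2 §4 (unit `b2b-balaban-pv25`), consumer
`…T4BankAgeYoung.lifetime_lt` (binders `hfound`, `hstep`); journal CLAIM T4-U5.E-REM-SIZELEDGER-K*
2026-08-19T03:12:56Z, unit `b2b-balaban-pv25` gen 6 — NEW leaf module, imports `…B16MergeGeometry` (unit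
`b2b-balaban-b02` gen 9) ONLY and modifies nothing; `…T4BankAgeYoung` (this lineage, p182815) is its consumer BY SHAPE
and is deliberately not imported)

HONEST FRAMING (cell `pub-balaban`, T4-DAG PAGE 1).  The cell's T4 target is the existence AND uniqueness of the
continuum limit of Bałaban's unit-scale averaged loop expectations on a finite torus — strictly beyond ultraviolet
stability ([Balaban1989LargeFieldII] Thm 1 p. 355); it is NOT the Yang–Mills mass gap and NOT the Clay problem.  This
module is FINITE COMBINATORICS AND REAL ARITHMETIC ONLY, over the cell's MODEL of the linear size — `TreeLength.treeLen`
(closed unit cubes of `ℤᵈ`, sup metric, infimum of lengths of admissible polygonal graphs; junk value `0`) and its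
containment-free companion `TreeLength.steinerLen` — and over `B16MergeGeometry`'s model of the printed graph `G` of
[Balaban1989LargeFieldII] p. 386 (`touchGraph`: two domains are joined iff they own touching cubes; `fam P S = ⋃_{i∈S} P i`;
`Step.Budget.GConn` = connectedness of the induced graph).  NOTHING of [Balaban1989LargeFieldII], [Balaban1988RG2Cluster]
or [Balaban1987RG1] is asserted here; the printed sentences this skeleton is modelled on (p. 386 (1.84) and the
endpoint-removal induction; p. 385 the enlargement inequality; p. 384 the re-covering chain) are quoted verbatim — render-read
— in the citation header of `…B16MergeGeometry` and in the record's §1 L4–L6; page numbers below are LOCATIONS, there is no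
quotation and no `[cite:]` tag in this file, and every printed / analytic input enters as a BINDER.

WHAT THIS MODULE ADDS (all kernel-checked, `d` arbitrary unless said).  `…T4BankAgeYoung` kernel-checked the arithmetic
skeleton of Lemma Y (small bank ⇒ recent creation) with the SIZE LEDGER entering through two binders of
`T4BankAgeYoung.lifetime_lt`: `hfound : Ψ 0 ≤ 2·14^d·f 0` (foundation) and
`hstep : ∀ i, Ψ (i+1) ≤ C·Ψ i + (2·14^d·f (i+1) + 2·d·v (i+1))` (one event per step of the ledger).  The record (§4 step
(2b)) derives these shapes from the merge-step geometry of p. 386.  Here that derivation is carried out ON THE MODEL: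
* §1 SUM FORM of the merge-step geometry [folklore over the model]: for a touch-tree-connected subfamily `S` of domains
  with admissible graphs, `d(⋃ S) + 2 ≤ Σ_{i∈S} (d(P i) + 2)` (`treeLen_fam_add_two_le_sum`, strong induction on a leaf
  of the touch graph — `Step.Budget.gconn_leaf` — with `B16MergeGeometry.treeLen_fam_le` as the step); the Steiner form
  for non-empty domains (`steinerLen_fam_add_two_le_sum`, via `steinerLen_fam_le`); the COVER form `Z ⊆ ⋃ S`
  (`steinerLen_cover_add_two_le_sum`, via `steinerLen_mono` — (1.84) is an INCLUSION and `treeLen` is not monotone under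
  inclusion, so the cover form lives on the Steiner size: cell GAPS G-b02g9-3 / DIVERGENCE D-b02g9.x, unit b02 gen 9);
  and the discharge of the tree-connectedness premise from face-connectedness of the union / of the covered domain BY
  NAME (`B16MergeGeometry.gconn_touchGraph_of_faceConnected`): `treeLen_fam_add_two_le_sum_of_faceConnected`,
  `steinerLen_cover_le_of_faceConnected`.
* §2 THE EVENT INEQUALITY of step (2b): members split into OLD parts `O` (domains `S(Z_j^{(n)})` of lineages alive before
  the event, bounded by the (2a) binder `d(P i) ≤ C·(σ i + 1)`, `σ i` = that lineage's epoch-start size — (2a) is the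
  located re-covering chain (α)/(β) of p. 384 and REMAINS A BINDER) and NEW parts `N` (regions born at the event, bounded
  by the (γ) binder `d(P i) + 2 ≤ E·(b i + 1)`, `b i` = the size credited to the bank — (γ) is the p. 385 enlargement
  inequality and REMAINS A BINDER; `new_binder_of_gamma` shows that the record's shape `d(X̃) ≤ 2·14^d·(b + ½)` gives it
  with `E = 2·14^d` when `d ≥ 1`): `d(⋃ (O ∪ N)) + 2 ≤ C·Σ_{O}(σ+1) + 2·#O + E·Σ_{N}(b+1)` (`event_size_le`; Steiner /
  cover form `event_steinerLen_cover_le`); the FOUNDATION case `O = ∅` (`foundation_size_le`) is the record's L5 shape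
  «size + 1 ≤ 2·14^d·Σ(size of the parts + 1)» ON THE MODEL, with one unit to spare.
* §3 THE POTENTIAL STEP of step (2c) in exactly the currency of `T4BankAgeYoung.lifetime_lt`: with `Ψ = Σ_alive (σ+1)`,
  an event consuming the old parts `Pold ⊆ A` (alive lineages) and founding one new lineage of size `dZ` gives
  `Ψ_after ≤ C·Ψ_before + (G + H) + 2·#Pold − 1` (`potential_step`; `G` = the new parts' `E·Σ(b+1)`, `H` = a bound for
  lineages founded separately in the same step), hence `Ψ_after ≤ C·Ψ_before + (2·14^d·F + 2·d·V)` whenever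
  `G + H ≤ 2·14^d·F`, `#Pold ≤ V`, `d ≥ 1` (`potential_step_hstep` — the binder `hstep` of `lifetime_lt`, whose `2·d·v`
  is print's `2d` per vertex; the model's join cost is `2 ≤ 2d`), and the foundation bound `d(Z₀) + 1 ≤ 2·14^d·f 0`
  (`foundation_hfound` — the binder `hfound`).
* §4 NON-VACUITY on `B16MergeGeometry.OneDim.P3` (three rows on the line forming one row): every premise of §1 is
  inhabited by a family on which the conclusion is not trivial.

WHAT REMAINS A BINDER / A READING (named, not hidden).  (2a) = (α)/(β) p. 384 with the re-covering constant `C = C_d`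
(cell analysis, record §4 (2a)); (γ) p. 385 (printed at `j = 1`; scale-free lattice geometry, not kernel-proved in the
tree); the identification of print's `d′_j` ([Balaban1987RG1] p. 257, «defined in terms of MR_j-cubes») with the model
`TreeLength.treeLen` (conventions (i)–(iii) of `…TreeLength`; advisory A1 of the XREAD of `…T4BankAgeYoung`, GAPS
C-pv18g9-3) — it is AT THIS MODULE'S STATEMENTS that the identification is consumed; (1.84) read as `Z = ⋃ S` for
`treeLen` (union reading) or as `Z ⊆ ⋃ S` for `steinerLen` (cover reading), never as a strict inclusion for `treeLen`;
the premise «every member domain meets `Z`» of `gconn_touchGraph_of_faceConnected` (located implicit premise of p. 386,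
`B16MergeGeometry.not_gconn_without_meet`); and the COUNTING binders `hD`, `hV` of `lifetime_lt` (numbers of events,
births and vertices along a sub-history), which are bookkeeping over histories that print does not have (print sums no
histories).  Cell census: discharged binder on the MODEL + kernel skeleton, NOT summit progress; NOT continuum, NOT Clay.
-/

namespace Literature.MathematicalPhysics.QuantumFieldTheory.Balaban1983to89.T4SizeLedger

open Literature.MathematicalPhysics.QuantumFieldTheory.Balaban1983to89
open Literature.MathematicalPhysics.QuantumFieldTheory.Balaban1983to89.B13ScaleTransfer
open Literature.MathematicalPhysics.QuantumFieldTheory.Balaban1983to89.TreeLength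
open Literature.MathematicalPhysics.QuantumFieldTheory.Balaban1983to89.B16MergeGeometry
open Literature.MathematicalPhysics.QuantumFieldTheory.Balaban1983to89.Step.Budget
open Finset

variable {d : ℕ}

/-! ## §1 The sum form of the merge-step geometry -/

section SumForm

variable {ι : Type*} [DecidableEq ι]

/-- SUM FORM, union reading: for a touch-tree-connected subfamily `S` of domains with admissible graphs,
`d(⋃ S) + 2 ≤ Σ_{i∈S} (d(P i) + 2)` — the endpoint-removal induction of p. 386 run to the end on the model (strong
induction: split off a leaf `x` of the touch graph, `B16MergeGeometry.treeLen_fam_le`, recurse on `S ∖ {x}`). [folklore] -/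
theorem treeLen_fam_add_two_le_sum {P : ι → Finset (Pt d)} (hP : ∀ i, ∃ T, Admissible (P i) T) :
    ∀ S : Finset ι, GConn (touchGraph P) S → treeLen (fam P S) + 2 ≤ ∑ i ∈ S, (treeLen (P i) + 2) := by
  intro S
  induction S using Finset.strongInduction with
  | H S ih =>
    intro hS
    by_cases h2 : 2 ≤ S.card
    · obtain ⟨x, hx, hY⟩ := gconn_leaf (touchGraph P) S hS h2
      have hstep := treeLen_fam_le hP hx h2 hS hY
      have hih := ih (S.erase x) (Finset.erase_ssubset hx) hY
      have hsum : ∑ i ∈ S, (treeLen (P i) + 2) = (treeLen (P x) + 2) + ∑ i ∈ S.erase x, (treeLen (P i) + 2) :=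
        (Finset.add_sum_erase S (fun i => treeLen (P i) + 2) hx).symm
      linarith
    · have hne := gconn_nonempty (touchGraph P) S hS
      have hcard : S.card = 1 := by have := Finset.card_pos.mpr hne; omega
      obtain ⟨y, rfl⟩ := Finset.card_eq_one.mp hcard
      rw [fam_singleton, Finset.sum_singleton]

/-- SUM FORM, Steiner size: for a touch-tree-connected subfamily `S` of NON-EMPTY domains,
`ℓ̃(⋃ S) + 2 ≤ Σ_{i∈S} (ℓ̃(P i) + 2)` (no connectedness of the member domains needed). [folklore] -/
theorem steinerLen_fam_add_two_le_sum {P : ι → Finset (Pt d)} (hP : ∀ i, (P i).Nonempty) :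
    ∀ S : Finset ι, GConn (touchGraph P) S → steinerLen (fam P S) + 2 ≤ ∑ i ∈ S, (steinerLen (P i) + 2) := by
  intro S
  induction S using Finset.strongInduction with
  | H S ih =>
    intro hS
    by_cases h2 : 2 ≤ S.card
    · obtain ⟨x, hx, hY⟩ := gconn_leaf (touchGraph P) S hS h2
      have hstep := steinerLen_fam_le hP hx h2 hS
      have hih := ih (S.erase x) (Finset.erase_ssubset hx) hY
      have hsum : ∑ i ∈ S, (steinerLen (P i) + 2) =
          (steinerLen (P x) + 2) + ∑ i ∈ S.erase x, (steinerLen (P i) + 2) :=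
        (Finset.add_sum_erase S (fun i => steinerLen (P i) + 2) hx).symm
      linarith
    · have hne := gconn_nonempty (touchGraph P) S hS
      have hcard : S.card = 1 := by have := Finset.card_pos.mpr hne; omega
      obtain ⟨y, rfl⟩ := Finset.card_eq_one.mp hcard
      rw [fam_singleton, Finset.sum_singleton]

/-- COVER FORM ((1.84) read as an inclusion, Steiner size): a non-empty `Z ⊆ ⋃ S`, `S` touch-tree-connected with
non-empty members ⇒ `ℓ̃(Z) + 2 ≤ Σ_{i∈S} (ℓ̃(P i) + 2)` (`B16MergeGeometry.steinerLen_mono`). [folklore] -/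
theorem steinerLen_cover_add_two_le_sum {P : ι → Finset (Pt d)} (hP : ∀ i, (P i).Nonempty) {S : Finset ι}
    (hS : GConn (touchGraph P) S) {Z : Finset (Pt d)} (hZ : Z.Nonempty) (hZS : Z ⊆ fam P S) :
    steinerLen Z + 2 ≤ ∑ i ∈ S, (steinerLen (P i) + 2) := by
  have h1 := steinerLen_mono hZS hZ
  have h2 := steinerLen_fam_add_two_le_sum hP S hS
  linarith

/-- Union reading with the tree-connectedness premise DISCHARGED: if the union `⋃ S` of a non-empty subfamily of domains
with admissible graphs is FACE-CONNECTED (a localization domain), the touch graph on `S` is connected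
(`B16MergeGeometry.gconn_touchGraph_of_faceConnected`, every member meets the union because it is non-empty), so the sum
form holds. [folklore] -/
theorem treeLen_fam_add_two_le_sum_of_faceConnected {P : ι → Finset (Pt d)} (hP : ∀ i, ∃ T, Admissible (P i) T)
    {S : Finset ι} (hSne : S.Nonempty) (hU : FaceConnected (fam P S)) :
    treeLen (fam P S) + 2 ≤ ∑ i ∈ S, (treeLen (P i) + 2) := by
  refine treeLen_fam_add_two_le_sum hP S
    (gconn_touchGraph_of_faceConnected P hU (Finset.Subset.refl _) (fun i hi => ?_) hSne)
  obtain ⟨T, hT⟩ := hP i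
  obtain ⟨z, hz⟩ := hT.finset_nonempty
  exact ⟨z, subset_fam P hi hz, hz⟩

/-- Cover reading with the tree-connectedness premise DISCHARGED: `Z` non-empty and face-connected, `Z ⊆ ⋃ S`, every
member of the non-empty subfamily `S` non-empty and MEETING `Z` (the located implicit premise of p. 386 —
`B16MergeGeometry.not_gconn_without_meet` shows it cannot be dropped) ⇒ `ℓ̃(Z) + 2 ≤ Σ_{i∈S} (ℓ̃(P i) + 2)`. [folklore] -/
theorem steinerLen_cover_le_of_faceConnected {P : ι → Finset (Pt d)} (hP : ∀ i, (P i).Nonempty) {S : Finset ι}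
    (hSne : S.Nonempty) {Z : Finset (Pt d)} (hZ : Z.Nonempty) (hZc : FaceConnected Z) (hZS : Z ⊆ fam P S)
    (hmeet : ∀ i ∈ S, ∃ z ∈ Z, z ∈ P i) :
    steinerLen Z + 2 ≤ ∑ i ∈ S, (steinerLen (P i) + 2) :=
  steinerLen_cover_add_two_le_sum hP (gconn_touchGraph_of_faceConnected P hZc hZS hmeet hSne) hZ hZS

/-- For a non-empty face-connected domain an `(2a)`/`(γ)`-type bound on the linear size `d` is inherited by the Steiner
size `ℓ̃ ≤ d` (`TreeLength.steinerLen_le_treeLen`) — so binders stated for `treeLen` feed the cover forms. [folklore] -/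
theorem steinerLen_le_of_treeLen_le {X : Finset (Pt d)} (hX : X.Nonempty) (hc : FaceConnected X) {B : ℝ}
    (h : treeLen X ≤ B) : steinerLen X ≤ B :=
  (steinerLen_le_treeLen hX hc).trans h

end SumForm

/-! ## §2 The event inequality (record §4 step (2b)) -/

section Event

variable {ι : Type*} [DecidableEq ι]

/-- THE EVENT INEQUALITY, union reading.  Old parts `O` with the (2a) binder `d(P i) ≤ C·(σ i + 1)`, new parts `N` with
the (γ) binder `d(P i) + 2 ≤ E·(b i + 1)`, `O`, `N` disjoint and `O ∪ N` touch-tree-connected, all members with admissible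
graphs ⇒ `d(⋃ (O ∪ N)) + 2 ≤ C·Σ_{O}(σ+1) + 2·#O + E·Σ_{N}(b+1)`. [folklore] -/
theorem event_size_le {P : ι → Finset (Pt d)} (hP : ∀ i, ∃ T, Admissible (P i) T) {O N : Finset ι}
    (hON : Disjoint O N) (hS : GConn (touchGraph P) (O ∪ N)) {C E : ℝ} {σ b : ι → ℝ}
    (hold : ∀ i ∈ O, treeLen (P i) ≤ C * (σ i + 1)) (hnew : ∀ i ∈ N, treeLen (P i) + 2 ≤ E * (b i + 1)) :
    treeLen (fam P (O ∪ N)) + 2 ≤ C * ∑ i ∈ O, (σ i + 1) + 2 * (O.card : ℝ) + E * ∑ i ∈ N, (b i + 1) := by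
  have h := treeLen_fam_add_two_le_sum hP (O ∪ N) hS
  rw [Finset.sum_union hON] at h
  have h1 : ∑ i ∈ N, (treeLen (P i) + 2) ≤ ∑ i ∈ N, E * (b i + 1) := Finset.sum_le_sum fun i hi => hnew i hi
  have h2 : ∑ i ∈ O, (treeLen (P i) + 2) ≤ ∑ i ∈ O, (C * (σ i + 1) + 2) :=
    Finset.sum_le_sum fun i hi => by linarith [hold i hi]
  have h3 : ∑ i ∈ O, (C * (σ i + 1) + 2) = C * ∑ i ∈ O, (σ i + 1) + 2 * (O.card : ℝ) := by
    rw [Finset.sum_add_distrib, ← Finset.mul_sum, Finset.sum_const, nsmul_eq_mul]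
    ring
  rw [← Finset.mul_sum] at h1
  linarith

/-- THE EVENT INEQUALITY, cover reading (Steiner size): the same with (1.84) as an inclusion `Z ⊆ ⋃ (O ∪ N)`, `Z`
non-empty, members non-empty, binders on the Steiner sizes of the parts. [folklore] -/
theorem event_steinerLen_cover_le {P : ι → Finset (Pt d)} (hP : ∀ i, (P i).Nonempty) {O N : Finset ι}
    (hON : Disjoint O N) (hS : GConn (touchGraph P) (O ∪ N)) {Z : Finset (Pt d)} (hZ : Z.Nonempty)
    (hZS : Z ⊆ fam P (O ∪ N)) {C E : ℝ} {σ b : ι → ℝ}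
    (hold : ∀ i ∈ O, steinerLen (P i) ≤ C * (σ i + 1)) (hnew : ∀ i ∈ N, steinerLen (P i) + 2 ≤ E * (b i + 1)) :
    steinerLen Z + 2 ≤ C * ∑ i ∈ O, (σ i + 1) + 2 * (O.card : ℝ) + E * ∑ i ∈ N, (b i + 1) := by
  have h := steinerLen_cover_add_two_le_sum hP hS hZ hZS
  rw [Finset.sum_union hON] at h
  have h1 : ∑ i ∈ N, (steinerLen (P i) + 2) ≤ ∑ i ∈ N, E * (b i + 1) := Finset.sum_le_sum fun i hi => hnew i hi
  have h2 : ∑ i ∈ O, (steinerLen (P i) + 2) ≤ ∑ i ∈ O, (C * (σ i + 1) + 2) :=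
    Finset.sum_le_sum fun i hi => by linarith [hold i hi]
  have h3 : ∑ i ∈ O, (C * (σ i + 1) + 2) = C * ∑ i ∈ O, (σ i + 1) + 2 * (O.card : ℝ) := by
    rw [Finset.sum_add_distrib, ← Finset.mul_sum, Finset.sum_const, nsmul_eq_mul]
    ring
  rw [← Finset.mul_sum] at h1
  linarith

/-- THE (γ)-SHAPE GIVES THE NEW-PART BINDER: from the record's enlargement shape `d(X̃) ≤ 2·14^d·(b + ½)` (p. 385,
a binder) one gets `d(X̃) + 2 ≤ 2·14^d·(b + 1)` as soon as `d ≥ 1` (`14^d ≥ 14 ≥ 2`). [folklore] -/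
theorem new_binder_of_gamma (hd : 1 ≤ d) {x b : ℝ} (h : x ≤ 2 * 14 ^ d * (b + 1 / 2)) :
    x + 2 ≤ 2 * 14 ^ d * (b + 1) := by
  have h14 : (14 : ℝ) ≤ 14 ^ d := by
    calc (14 : ℝ) = 14 ^ 1 := (pow_one _).symm
      _ ≤ 14 ^ d := pow_le_pow_right₀ (by norm_num) hd
  have e1 : 2 * (14 : ℝ) ^ d * (b + 1 / 2) = 2 * 14 ^ d * b + 14 ^ d := by ring
  have e2 : 2 * (14 : ℝ) ^ d * (b + 1) = 2 * 14 ^ d * b + 2 * 14 ^ d := by ring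
  rw [e1] at h
  rw [e2]
  linarith

/-- THE FOUNDATION CASE (`O = ∅`): a lineage's first domain, the touch-tree-connected union of regions born together, has
`d(⋃ N) + 2 ≤ E·Σ_{N}(b+1)` — with `E = 2·14^d` this is the record's L5 shape «size + 1 ≤ 2·14^d·Σ(sizes + 1)» ON THE
MODEL with one unit to spare. [folklore] -/
theorem foundation_size_le {P : ι → Finset (Pt d)} (hP : ∀ i, ∃ T, Admissible (P i) T) {N : Finset ι}
    (hS : GConn (touchGraph P) N) {E : ℝ} {b : ι → ℝ} (hnew : ∀ i ∈ N, treeLen (P i) + 2 ≤ E * (b i + 1)) :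
    treeLen (fam P N) + 2 ≤ E * ∑ i ∈ N, (b i + 1) := by
  have h := treeLen_fam_add_two_le_sum hP N hS
  have h1 : ∑ i ∈ N, (treeLen (P i) + 2) ≤ ∑ i ∈ N, E * (b i + 1) := Finset.sum_le_sum fun i hi => hnew i hi
  rw [← Finset.mul_sum] at h1
  linarith

end Event

/-! ## §3 The potential step (record §4 step (2c)) in the currency of `T4BankAgeYoung.lifetime_lt` -/

section Potential

variable {κ : Type*} [DecidableEq κ]

/-- THE POTENTIAL STEP.  Alive lineages `A` with epoch-start sizes `s ≥ 0`, `Ψ_before = Σ_{A}(s+1)`; an event consumes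
the old parts `Pold ⊆ A` and founds ONE new lineage of size `dZ` with the event inequality
`dZ + 2 ≤ C·Σ_{Pold}(s+1) + 2·#Pold + G`; lineages founded separately in the same step contribute `Φ ≤ H`; `C ≥ 1`.
Then `Ψ_after = Σ_{A∖Pold}(s+1) + (dZ+1) + Φ ≤ C·Ψ_before + (G + H) + 2·#Pold − 1`. [folklore] -/
theorem potential_step {A Pold : Finset κ} (hP : Pold ⊆ A) {s : κ → ℝ} (hs : ∀ i ∈ A, 0 ≤ s i) {C dZ G Φ H : ℝ}
    (hC : 1 ≤ C) (hZ : dZ + 2 ≤ C * ∑ i ∈ Pold, (s i + 1) + 2 * (Pold.card : ℝ) + G) (hΦ : Φ ≤ H) :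
    ∑ i ∈ A \ Pold, (s i + 1) + (dZ + 1) + Φ ≤ C * ∑ i ∈ A, (s i + 1) + (G + H) + 2 * (Pold.card : ℝ) - 1 := by
  have hsplit : ∑ i ∈ A, (s i + 1) = ∑ i ∈ A \ Pold, (s i + 1) + ∑ i ∈ Pold, (s i + 1) :=
    (Finset.sum_sdiff hP).symm
  have hrest : 0 ≤ ∑ i ∈ A \ Pold, (s i + 1) :=
    Finset.sum_nonneg fun i hi => by have := hs i (Finset.mem_sdiff.1 hi).1; linarith
  have h1 : ∑ i ∈ A \ Pold, (s i + 1) ≤ C * ∑ i ∈ A \ Pold, (s i + 1) := le_mul_of_one_le_left hrest hC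
  rw [hsplit, mul_add]
  linarith

/-- THE POTENTIAL STEP IN THE `hstep` CURRENCY of `T4BankAgeYoung.lifetime_lt`
(`Ψ (i+1) ≤ C·Ψ i + (2·14^d·f (i+1) + 2·d·v (i+1))`): if the sizes credited at the step satisfy `G + H ≤ 2·14^d·F` and the
vertex count satisfies `#Pold ≤ V`, then for `d ≥ 1` (print's `2d` per vertex dominates the model's `2` per join)
`Ψ_after ≤ C·Ψ_before + (2·14^d·F + 2·d·V)`. [folklore] -/
theorem potential_step_hstep (hd : 1 ≤ d) {A Pold : Finset κ} (hP : Pold ⊆ A) {s : κ → ℝ} (hs : ∀ i ∈ A, 0 ≤ s i)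
    {C dZ G Φ H F V : ℝ} (hC : 1 ≤ C)
    (hZ : dZ + 2 ≤ C * ∑ i ∈ Pold, (s i + 1) + 2 * (Pold.card : ℝ) + G) (hΦ : Φ ≤ H)
    (hGH : G + H ≤ 2 * 14 ^ d * F) (hV : (Pold.card : ℝ) ≤ V) :
    ∑ i ∈ A \ Pold, (s i + 1) + (dZ + 1) + Φ ≤ C * ∑ i ∈ A, (s i + 1) + (2 * 14 ^ d * F + 2 * d * V) := by
  have h := potential_step hP hs hC hZ hΦ
  have hd' : (1 : ℝ) ≤ d := by exact_mod_cast hd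
  have hV0 : 0 ≤ V := (Nat.cast_nonneg _).trans hV
  have hdV : V ≤ (d : ℝ) * V := le_mul_of_one_le_left hV0 hd'
  linarith

/-- THE FOUNDATION BOUND IN THE `hfound` CURRENCY of `T4BankAgeYoung.lifetime_lt` (`Ψ 0 ≤ 2·14^d·f 0`, `Ψ 0 = d(Z₀) + 1`,
`f 0 = Σ(b+1)` over the regions founding the lineage): from `foundation_size_le` with `E = 2·14^d`. [folklore] -/
theorem foundation_hfound {ι : Type*} [DecidableEq ι] {P : ι → Finset (Pt d)} (hP : ∀ i, ∃ T, Admissible (P i) T)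
    {N : Finset ι} (hS : GConn (touchGraph P) N) {b : ι → ℝ}
    (hnew : ∀ i ∈ N, treeLen (P i) + 2 ≤ 2 * 14 ^ d * (b i + 1)) :
    treeLen (fam P N) + 1 ≤ 2 * 14 ^ d * ∑ i ∈ N, (b i + 1) := by
  have h := foundation_size_le hP hS hnew
  linarith

/-- ONE LEDGER STEP ASSEMBLED from the geometry: alive lineages `A` (sizes `s ≥ 0`), an event whose vertex family
`O ∪ N` (disjoint, touch-tree-connected, admissible members) has old parts indexed by `Pold ⊆ A` through `e : Pold ≃ O`…
— kept ABSTRACT here: the caller supplies the event inequality in the form produced by `event_size_le` (with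
`Σ_{O}(σ+1)` rewritten over `Pold`), and gets the `hstep` shape.  This is `potential_step_hstep`; the example below shows
the two fit together when old parts are indexed by the lineages themselves (`O = Pold`, `σ = s`). [folklore] -/
example (hd : 1 ≤ d) {P : κ → Finset (Pt d)} (hPa : ∀ i, ∃ T, Admissible (P i) T) {A Pold N : Finset κ}
    (hP : Pold ⊆ A) (hON : Disjoint Pold N) (hS : GConn (touchGraph P) (Pold ∪ N)) {s b : κ → ℝ}
    (hs : ∀ i ∈ A, 0 ≤ s i) {C Φ H F V : ℝ} (hC : 1 ≤ C)
    (hold : ∀ i ∈ Pold, treeLen (P i) ≤ C * (s i + 1))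
    (hnew : ∀ i ∈ N, treeLen (P i) + 2 ≤ 2 * 14 ^ d * (b i + 1)) (hΦ : Φ ≤ H)
    (hGH : 2 * 14 ^ d * ∑ i ∈ N, (b i + 1) + H ≤ 2 * 14 ^ d * F) (hV : (Pold.card : ℝ) ≤ V) :
    ∑ i ∈ A \ Pold, (s i + 1) + (treeLen (fam P (Pold ∪ N)) + 1) + Φ ≤
      C * ∑ i ∈ A, (s i + 1) + (2 * 14 ^ d * F + 2 * d * V) :=
  potential_step_hstep hd hP hs hC (event_size_le hPa hON hS hold hnew) hΦ hGH hV

end Potential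

/-! ## §4 Non-vacuity: the three-piece family on the line -/

section NonVacuity

open Literature.MathematicalPhysics.QuantumFieldTheory.Balaban1983to89.B16MergeGeometry.OneDim

/-- Every premise of `treeLen_fam_add_two_le_sum_of_faceConnected` is inhabited by `B16MergeGeometry.OneDim.P3 n` — the
rows `{0..n}`, `{n+1}`, `{n+2..2n+2}` — whose union is the face-connected row `{0..2n+2}`. [folklore] -/
theorem sumForm_P3 (n : ℕ) :
    treeLen (row 0 (2 * n + 2)) + 2 ≤ ∑ i ∈ (Finset.univ : Finset (Fin 3)), (treeLen (P3 n i) + 2) := by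
  have hP : ∀ i, ∃ T, Admissible (P3 n i) T := by
    intro i
    fin_cases i
    · exact exists_admissible_row 0 n
    · exact exists_admissible_row _ 0
    · exact exists_admissible_row _ n
  have h := treeLen_fam_add_two_le_sum_of_faceConnected hP (S := Finset.univ) ⟨0, Finset.mem_univ _⟩
    (by rw [fam_P3_univ]; exact faceConnected_row 0 (2 * n + 2))
  rwa [fam_P3_univ] at h

/-- … and the conclusion is NOT trivial there: the left side is `≥ 2n + 3` (`B16MergeGeometry.OneDim.le_treeLen_row`),
so the sum of the three member sizes plus `6` is at least `2n + 3` — the two end rows carry the length. [folklore] -/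
example (n : ℕ) : (2 * n + 3 : ℝ) ≤ ∑ i ∈ (Finset.univ : Finset (Fin 3)), (treeLen (P3 n i) + 2) := by
  have h1 := sumForm_P3 n
  have h2 := le_treeLen_row n
  linarith

end NonVacuity

end Literature.MathematicalPhysics.QuantumFieldTheory.Balaban1983to89.T4SizeLedger
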